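import Summits.QuantumFields.YangMills.Theorems.FluctuationComparisonRegPrIntLOrganTangentGoodSetTailPathHolder
import HarnessLib

/-!
# Route `UnitScaleTilt` — crux `FluctuationComparisonRegPrIntL` (stmt-QuantumFields-20520, rung R3), PATH-B organ: «THE JOINT-AVERAGED PER-`t` TAIL IS FREE» —
# along the interpolated fibre path `ŵ_t ∝ χ·ρ^t·ρ′^{1−t}·J` the UN-NORMALISED (joint) mass of any fine event is at most the larger of the two ENDPOINT unconditional
# masses, uniformly in `t ∈ [0,1]`, with NO Jensen∕KL letter (SPEC (xv-b) «A5 TAIL THRESHOLD» after LEAD RULING №63 «J-EXT STANDS»; UV3-NODE §106.1 + §106 ADDENDUM)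

Cell `ym3-torus` (YM ladder rung R3 = continuum `SU(2)` Yang–Mills on the three-torus — a RUNG: NOT d = 4, NOT infinite volume, NOT a mass gap, NOT Clay).
Width seat `ym-ust-20520-w4` (gen 27), (xv-b) lane; door-in-waiting GO = LEAD `ym-ust-20520-w3` g29 №1 (3) + ★★OWNER desk g49 RULING №111 (c) + `ym3-torus-px19` g24 №19
(content notes (i)–(iii)); `--kind proof --supports stmt-QuantumFields-20520 --as helper`, count-neutral, DEFINITION-FREE, no registry ∕ binder ∕ `Lines/` edit, default
heartbeats, `autoImplicit false`.  Builds on ✓`…OrganTangentGoodSetTailPathHolder` (the pointwise identity `wNum_t = wNum₁^t·wNum₀^{1−t}` and Hölder along the path).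

WHAT (LEAD w3 g28 №89's one-line ledger of record for (xv-b) — «JOINT-averaged per-`t` tail FREE (frame identity + Hölder + two η♭)»; UV3-NODE §106.1 + ADDENDUM (a)).
In the frame's letters (`mwCut` = the multi-window soft cut `χ`, `wNum_t = χ(Φ)·ρ_Ts(Φ)^t·ρ′_Ts(Φ)^{1−t}·J` the UN-normalised interpolated fibre weight;
✓`…RunpairOrganFibreLawDefs`):
* §1 the FRAME IDENTITY as a door (§106.1): from the row's disintegration and support clauses — taken VERBATIM as hypotheses `hdis`, `hS` (the texts of
  ✓`…RunpairOrganFibreLawJSqEDefs` l.117: `(fieldMeasure Ts).restrict (descendTo⁻¹ A ∩ S) = ((((fieldMeasure j).restrict A).prod τ).withDensity J).map Φ` and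
  `(∀ n …, PlaqSmall (24∕25·θ_n) (descendTo n Ts U)) → U ∈ S`; with `hχsupp` this is `supp χ ⊆ S`) — for every measurable window set `A` and fine event `B`,
  ★`setLIntegral_wNum_one_prod_eq` ∕ `…zero…`: `∫⁻_{Φ⁻¹B} wNum₁ d((fieldMeasure_j|_A) ⊗ τ) = ∫⁻_{B ∩ descendTo⁻¹A} χ·ρ_Ts d(fieldMeasure_Ts)` (resp. `wNum₀`, `ρ′_Ts`) — an
  EXACT change of variables; then `0 ≤ χ ≤ 1` and the row's density clause `μ Ts = fieldMeasure.withDensity (ofReal ∘ ρ Ts)` give `≤ μ_Ts(B)`.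
* §2 ★★`setLIntegral_wNum_prod_le_max_endpointMass`: `∫⁻_{Φ⁻¹B} wNum_t d((fieldMeasure_j|_A) ⊗ τ) ≤ (μ_Ts B)^t·(μ′_Ts B)^{1−t} ≤ max(μ_Ts B, μ′_Ts B)` for every
  `t ∈ [0,1]`, and its Tonelli reading ★★`lintegral_fibreTail_le_max_endpointMass`: `∫⁻_{V ∈ A} (∫⁻_{z : Φ(V,z) ∈ B} wNum_t(V,z) dτ) d(fieldMeasure_j) ≤ max(μ_Ts B, μ′_Ts B)`.
  READ IT CORRECTLY (§106 ADDENDUM (b)): the inner integral is `Z_t(V)·tail_t(V)`, so the left member is the fibre tail AVERAGED AGAINST THE INTERPOLATED MARGINAL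
  `Z_t(V) dV` — NOT against a run's marginal `Z₀ dV` ∕ `Z₁ dV`, and NOT pointwise in `V`; in that currency the interpolation costs nothing and NO `J`∕KL∕variance letter
  occurs.  The conclusion is in the η-SHAPE: with `B := {U | ¬ PlaqSmall θ′ U}` (`θ′ = θ_Ts∕4 − 3·Db·rc`, ✓`…OrganTangentGoodSetMargin`) an η♭ letter
  `μ_Ts{¬PlaqSmall θ′} ≤ ofReal η♭` (the row's η-letter shape at the reduced threshold; print: [Balaban1985UV3] (67)–(71) p. 273 — NOT asserted here) docks by `le_trans`:
  ★`lintegral_fibreTail_compl_plaqSmall_le_of_eta`, `≤ ofReal (max η♭ η♭′)`.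

WHY (RULING №63).  The typed J-chain (✓p832596 → ✓p833183) bounds the NORMALISED tail `∫_{Goodᶜ} ŵ_t` by endpoint tails times `e^{J}`-factors, `J₀ = KL(ŵ₀‖ŵ₁)`
EXTENSIVE in the fibre volume — a factor born ONLY in the fibrewise normalisation `Z_t(V) = ∫ wNum_t(V,·) dτ`.  This file never divides by `Z_t`.

HONEST FRAMING: measure-theoretic [folklore] (change of variables, Tonelli, Hölder via the companion) over the frame's HYPOTHESIS letters (the disintegration ∕ support ∕
density clauses are hypotheses in the row's shape); NO sup-currency consumer today — A5's Good-set clause is POINTWISE in the law point `Xw`, and that pointwise cell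
(§106.2: event transport + density ratio + ball average + ONE LOCAL conditional lower bound = decoupling content) stays OPEN and is NOT advanced by this file: a
DOOR-IN-WAITING (RULING-№59 mechanics).  Nothing of Bałaban's analysis ((67)–(71) included) is asserted or proved; (xv-b) is NOT discharged; `SpreadFibreLawHJ(sq)`(ᴱ) ∕
`OrganDischargeInputsHJ(sq)` (every edition) UNDISCHARGED; the five registered stubs of `Lines/runpair_organ.lean` (registry 3732b7df, untouched), crux 20520 and `YM3TorusSU2`
are NOT proved; rung R3 = SU(2) YM₃ on T³ at fixed lattice data — NOT d = 4, NOT infinite volume, NOT a mass gap, NOT Clay; the Yang–Mills mass gap is NOT proved.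
-/

set_option autoImplicit false

noncomputable section

namespace Summit.QuantumFields.YangMills.Theorems.OrganTangentGoodSetTailJointHolder

open MeasureTheory Filter Topology
open scoped ENNReal NNReal
open Literature.MathematicalPhysics.QuantumFieldTheory.Balaban1983to89 T3ContinuumYM3Torus T3NestedUnitLaws
  T3UnitLawDensityEML T4Continuum T3UnitScaleTilt T3LevelShift T3TiltDescent
open Summit.QuantumFields.YangMills.Theorems.FluctuationComparisonRegPrIntLRunpairOrganFibreLaw (mwCut wNum wgt)
open Summit.QuantumFields.YangMills.Theorems.OrganTangentFibreWeightNormalisation (wNum_nonneg)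
open Summit.QuantumFields.YangMills.Theorems.OrganTangentGoodSetTailPathHolder (measurable_wNum_uncurry setLIntegral_wNum_prod_le_max)

/-! ## §1 The frame identity: the joint endpoint mass of a fine event IS a cut unconditional mass (UV3-NODE §106.1) -/

/-- **Change of variables through the fibred chart** — for a weight `w(V,z) = χ(Φ(V,z))·g(Φ(V,z))·J(V,z)` (`g` measurable), the row's disintegration clause `hdis` and
support clause `hS` (VERBATIM the shapes of ✓`…RunpairOrganFibreLawJSqEDefs` l.117; `χ ≠ 0 ⟹ ∈ S` via `hχsupp`) give, for measurable `A` (window set) and `B` (fine event):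
`∫⁻_{Φ⁻¹B} ofReal w d((fieldMeasure_j|_A) ⊗ τ) = ∫⁻_{B ∩ descendTo⁻¹A} ofReal(χ·g) d(fieldMeasure_Ts)` (the restriction to `S` drops since `χ·g` vanishes off `S`). [folklore] -/
theorem setLIntegral_prod_eq_of_chart (F : T3Family) (γ b₀ p₀ : ℝ) (j Ts : ℕ) (hjTs : j + 1 ≤ Ts)
    (hχm : Measurable (mwCut F γ b₀ p₀ j Ts))
    (hχsupp : ∀ U, mwCut F γ b₀ p₀ j Ts U ≠ 0 → ∀ (n : ℕ) (hjn : j + 1 ≤ n) (hnK : n ≤ Ts), PlaqSmall (24 / 25 * θBal F.L γ b₀ p₀ n) (descendTo F ℰp n Ts hnK U))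
    {Z : Type} [MeasurableSpace Z] (τ : Measure Z)
    (Φ : GaugeField (F.P j) 0 ↥(Matrix.specialUnitaryGroup (Fin 2) ℂ) × Z → GaugeField (F.P Ts) 0 ↥(Matrix.specialUnitaryGroup (Fin 2) ℂ))
    (J : GaugeField (F.P j) 0 ↥(Matrix.specialUnitaryGroup (Fin 2) ℂ) × Z → ℝ≥0)
    (S : Set (GaugeField (F.P Ts) 0 ↥(Matrix.specialUnitaryGroup (Fin 2) ℂ))) (hΦm : Measurable Φ) (hJm : Measurable J) (hSm : MeasurableSet S)
    (hS : ∀ U, (∀ (n : ℕ) (hjn : j + 1 ≤ n) (hnK : n ≤ Ts), PlaqSmall (24 / 25 * θBal F.L γ b₀ p₀ n) (descendTo F ℰp n Ts hnK U)) → U ∈ S)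
    (hdis : ∀ A : Set (GaugeField (F.P j) 0 ↥(Matrix.specialUnitaryGroup (Fin 2) ℂ)), MeasurableSet A →
      (fieldMeasure (F.P Ts) 0 ↥(Matrix.specialUnitaryGroup (Fin 2) ℂ)).restrict (descendTo F ℰp j Ts (Nat.le_of_succ_le hjTs) ⁻¹' A ∩ S)
        = ((((fieldMeasure (F.P j) 0 ↥(Matrix.specialUnitaryGroup (Fin 2) ℂ)).restrict A).prod τ).withDensity (fun p => (J p : ENNReal))).map Φ)
    (g : GaugeField (F.P Ts) 0 ↥(Matrix.specialUnitaryGroup (Fin 2) ℂ) → ℝ) (hgm : Measurable g)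
    (w : GaugeField (F.P j) 0 ↥(Matrix.specialUnitaryGroup (Fin 2) ℂ) × Z → ℝ) (hw : ∀ p, w p = mwCut F γ b₀ p₀ j Ts (Φ p) * g (Φ p) * (J p : ℝ))
    {A : Set (GaugeField (F.P j) 0 ↥(Matrix.specialUnitaryGroup (Fin 2) ℂ))} (hA : MeasurableSet A)
    {B : Set (GaugeField (F.P Ts) 0 ↥(Matrix.specialUnitaryGroup (Fin 2) ℂ))} (hB : MeasurableSet B) :
    ∫⁻ p in Φ ⁻¹' B, ENNReal.ofReal (w p) ∂(((fieldMeasure (F.P j) 0 ↥(Matrix.specialUnitaryGroup (Fin 2) ℂ)).restrict A).prod τ)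
      = ∫⁻ U in B ∩ (descendTo F ℰp j Ts (Nat.le_of_succ_le hjTs) ⁻¹' A), ENNReal.ofReal (mwCut F γ b₀ p₀ j Ts U * g U)
          ∂(fieldMeasure (F.P Ts) 0 ↥(Matrix.specialUnitaryGroup (Fin 2) ℂ)) := by
  set π : Measure (GaugeField (F.P j) 0 ↥(Matrix.specialUnitaryGroup (Fin 2) ℂ) × Z) :=
    ((fieldMeasure (F.P j) 0 ↥(Matrix.specialUnitaryGroup (Fin 2) ℂ)).restrict A).prod τ with hπ
  set G : GaugeField (F.P Ts) 0 ↥(Matrix.specialUnitaryGroup (Fin 2) ℂ) → ℝ≥0∞ := fun U => ENNReal.ofReal (mwCut F γ b₀ p₀ j Ts U * g U) with hG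
  have hGm : Measurable G := (hχm.mul hgm).ennreal_ofReal
  have hJ' : Measurable fun p : GaugeField (F.P j) 0 ↥(Matrix.specialUnitaryGroup (Fin 2) ℂ) × Z => (J p : ℝ≥0∞) := hJm.coe_nnreal_ennreal
  have key : ∀ p : GaugeField (F.P j) 0 ↥(Matrix.specialUnitaryGroup (Fin 2) ℂ) × Z,
      ENNReal.ofReal (w p) = ((fun p => (J p : ℝ≥0∞)) * fun p => G (Φ p)) p := by
    intro p
    rw [hw p, Pi.mul_apply, ENNReal.ofReal_mul' (NNReal.coe_nonneg _), ENNReal.ofReal_coe_nnreal, mul_comm]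
  have hE : MeasurableSet (Φ ⁻¹' B) := hΦm hB
  -- `G` vanishes off `S` (`χ ≠ 0 ⟹ ∈ S`), so restricting to `S` changes nothing
  have hGS : ∀ U, G U = S.indicator G U := by
    intro U
    by_cases hU : U ∈ S
    · rw [Set.indicator_of_mem hU]
    · rw [Set.indicator_of_notMem hU]
      have hχ : mwCut F γ b₀ p₀ j Ts U = 0 := by
        by_contra h
        exact hU (hS U (hχsupp U h))
      simp only [hG, hχ, zero_mul, ENNReal.ofReal_zero]
  calc ∫⁻ p in Φ ⁻¹' B, ENNReal.ofReal (w p) ∂π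
      = ∫⁻ p in Φ ⁻¹' B, ((fun p => (J p : ℝ≥0∞)) * fun p => G (Φ p)) p ∂π := lintegral_congr fun p => key p
    _ = ∫⁻ p in Φ ⁻¹' B, G (Φ p) ∂(π.withDensity fun p => (J p : ℝ≥0∞)) := (setLIntegral_withDensity_eq_setLIntegral_mul π hJ' (hGm.comp hΦm) hE).symm
    _ = ∫⁻ U in B, G U ∂((π.withDensity fun p => (J p : ℝ≥0∞)).map Φ) := (setLIntegral_map hB hGm hΦm).symm
    _ = ∫⁻ U in B, G U ∂((fieldMeasure (F.P Ts) 0 ↥(Matrix.specialUnitaryGroup (Fin 2) ℂ)).restrict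
          (descendTo F ℰp j Ts (Nat.le_of_succ_le hjTs) ⁻¹' A ∩ S)) := by rw [hdis A hA]
    _ = ∫⁻ U in B ∩ (descendTo F ℰp j Ts (Nat.le_of_succ_le hjTs) ⁻¹' A ∩ S), G U ∂(fieldMeasure (F.P Ts) 0 ↥(Matrix.specialUnitaryGroup (Fin 2) ℂ)) := by
        rw [Measure.restrict_restrict hB]
    _ = ∫⁻ U in B ∩ (descendTo F ℰp j Ts (Nat.le_of_succ_le hjTs) ⁻¹' A), G U ∂(fieldMeasure (F.P Ts) 0 ↥(Matrix.specialUnitaryGroup (Fin 2) ℂ)) := by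
        rw [show B ∩ (descendTo F ℰp j Ts (Nat.le_of_succ_le hjTs) ⁻¹' A ∩ S) = S ∩ (B ∩ (descendTo F ℰp j Ts (Nat.le_of_succ_le hjTs) ⁻¹' A)) by
              ext U; simp only [Set.mem_inter_iff]; tauto,
          ← Measure.restrict_restrict hSm, ← lintegral_indicator hSm]
        exact lintegral_congr fun U => (hGS U).symm

/-- ★ **FRAME IDENTITY, run `K` (`t = 1`)**: `∫⁻_{Φ⁻¹B} wNum₁ d((fieldMeasure_j|_A) ⊗ τ) = ∫⁻_{B ∩ descendTo⁻¹A} χ·ρ_Ts d(fieldMeasure_Ts)` — the joint un-normalised `ŵ₁`-mass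
of `B` over `A` IS the cut run-`K` mass of `B ∩ descendTo⁻¹A` at height `Ts` (UV3-NODE §106.1). [folklore] -/
theorem setLIntegral_wNum_one_prod_eq (F : T3Family) (γ b₀ p₀ : ℝ) (j Ts : ℕ) (hjTs : j + 1 ≤ Ts)
    (ρ ρ' : (i : ℕ) → GaugeField (F.P i) 0 ↥(Matrix.specialUnitaryGroup (Fin 2) ℂ) → ℝ) (hρm : Measurable (ρ Ts))
    (hχm : Measurable (mwCut F γ b₀ p₀ j Ts))
    (hχsupp : ∀ U, mwCut F γ b₀ p₀ j Ts U ≠ 0 → ∀ (n : ℕ) (hjn : j + 1 ≤ n) (hnK : n ≤ Ts), PlaqSmall (24 / 25 * θBal F.L γ b₀ p₀ n) (descendTo F ℰp n Ts hnK U))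
    {Z : Type} [MeasurableSpace Z] (τ : Measure Z)
    (Φ : GaugeField (F.P j) 0 ↥(Matrix.specialUnitaryGroup (Fin 2) ℂ) × Z → GaugeField (F.P Ts) 0 ↥(Matrix.specialUnitaryGroup (Fin 2) ℂ))
    (J : GaugeField (F.P j) 0 ↥(Matrix.specialUnitaryGroup (Fin 2) ℂ) × Z → ℝ≥0)
    (S : Set (GaugeField (F.P Ts) 0 ↥(Matrix.specialUnitaryGroup (Fin 2) ℂ))) (hΦm : Measurable Φ) (hJm : Measurable J) (hSm : MeasurableSet S)
    (hS : ∀ U, (∀ (n : ℕ) (hjn : j + 1 ≤ n) (hnK : n ≤ Ts), PlaqSmall (24 / 25 * θBal F.L γ b₀ p₀ n) (descendTo F ℰp n Ts hnK U)) → U ∈ S)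
    (hdis : ∀ A : Set (GaugeField (F.P j) 0 ↥(Matrix.specialUnitaryGroup (Fin 2) ℂ)), MeasurableSet A →
      (fieldMeasure (F.P Ts) 0 ↥(Matrix.specialUnitaryGroup (Fin 2) ℂ)).restrict (descendTo F ℰp j Ts (Nat.le_of_succ_le hjTs) ⁻¹' A ∩ S)
        = ((((fieldMeasure (F.P j) 0 ↥(Matrix.specialUnitaryGroup (Fin 2) ℂ)).restrict A).prod τ).withDensity (fun p => (J p : ENNReal))).map Φ)
    {A : Set (GaugeField (F.P j) 0 ↥(Matrix.specialUnitaryGroup (Fin 2) ℂ))} (hA : MeasurableSet A)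
    {B : Set (GaugeField (F.P Ts) 0 ↥(Matrix.specialUnitaryGroup (Fin 2) ℂ))} (hB : MeasurableSet B) :
    ∫⁻ p in Φ ⁻¹' B, ENNReal.ofReal (wNum F γ b₀ p₀ j Ts ρ ρ' Φ J 1 p.1 p.2) ∂(((fieldMeasure (F.P j) 0 ↥(Matrix.specialUnitaryGroup (Fin 2) ℂ)).restrict A).prod τ)
      = ∫⁻ U in B ∩ (descendTo F ℰp j Ts (Nat.le_of_succ_le hjTs) ⁻¹' A), ENNReal.ofReal (mwCut F γ b₀ p₀ j Ts U * ρ Ts U)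
          ∂(fieldMeasure (F.P Ts) 0 ↥(Matrix.specialUnitaryGroup (Fin 2) ℂ)) :=
  setLIntegral_prod_eq_of_chart F γ b₀ p₀ j Ts hjTs hχm hχsupp τ Φ J S hΦm hJm hSm hS hdis (ρ Ts) hρm
    (fun p => wNum F γ b₀ p₀ j Ts ρ ρ' Φ J 1 p.1 p.2)
    (fun p => by simp only [wNum, Real.rpow_eq_pow, Real.rpow_one, sub_self, Real.rpow_zero, mul_one, Prod.mk.eta]) hA hB

/-- ★ **FRAME IDENTITY, run `K′` (endpoint `t = 0`)**: `∫⁻_{Φ⁻¹B} wNum₀ d((fieldMeasure_j|_A) ⊗ τ) = ∫⁻_{B ∩ descendTo⁻¹A} χ·ρ′_Ts d(fieldMeasure_Ts)`. [folklore] -/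
theorem setLIntegral_wNum_zero_prod_eq (F : T3Family) (γ b₀ p₀ : ℝ) (j Ts : ℕ) (hjTs : j + 1 ≤ Ts)
    (ρ ρ' : (i : ℕ) → GaugeField (F.P i) 0 ↥(Matrix.specialUnitaryGroup (Fin 2) ℂ) → ℝ) (hρ'm : Measurable (ρ' Ts))
    (hχm : Measurable (mwCut F γ b₀ p₀ j Ts))
    (hχsupp : ∀ U, mwCut F γ b₀ p₀ j Ts U ≠ 0 → ∀ (n : ℕ) (hjn : j + 1 ≤ n) (hnK : n ≤ Ts), PlaqSmall (24 / 25 * θBal F.L γ b₀ p₀ n) (descendTo F ℰp n Ts hnK U))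
    {Z : Type} [MeasurableSpace Z] (τ : Measure Z)
    (Φ : GaugeField (F.P j) 0 ↥(Matrix.specialUnitaryGroup (Fin 2) ℂ) × Z → GaugeField (F.P Ts) 0 ↥(Matrix.specialUnitaryGroup (Fin 2) ℂ))
    (J : GaugeField (F.P j) 0 ↥(Matrix.specialUnitaryGroup (Fin 2) ℂ) × Z → ℝ≥0)
    (S : Set (GaugeField (F.P Ts) 0 ↥(Matrix.specialUnitaryGroup (Fin 2) ℂ))) (hΦm : Measurable Φ) (hJm : Measurable J) (hSm : MeasurableSet S)
    (hS : ∀ U, (∀ (n : ℕ) (hjn : j + 1 ≤ n) (hnK : n ≤ Ts), PlaqSmall (24 / 25 * θBal F.L γ b₀ p₀ n) (descendTo F ℰp n Ts hnK U)) → U ∈ S)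
    (hdis : ∀ A : Set (GaugeField (F.P j) 0 ↥(Matrix.specialUnitaryGroup (Fin 2) ℂ)), MeasurableSet A →
      (fieldMeasure (F.P Ts) 0 ↥(Matrix.specialUnitaryGroup (Fin 2) ℂ)).restrict (descendTo F ℰp j Ts (Nat.le_of_succ_le hjTs) ⁻¹' A ∩ S)
        = ((((fieldMeasure (F.P j) 0 ↥(Matrix.specialUnitaryGroup (Fin 2) ℂ)).restrict A).prod τ).withDensity (fun p => (J p : ENNReal))).map Φ)
    {A : Set (GaugeField (F.P j) 0 ↥(Matrix.specialUnitaryGroup (Fin 2) ℂ))} (hA : MeasurableSet A)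
    {B : Set (GaugeField (F.P Ts) 0 ↥(Matrix.specialUnitaryGroup (Fin 2) ℂ))} (hB : MeasurableSet B) :
    ∫⁻ p in Φ ⁻¹' B, ENNReal.ofReal (wNum F γ b₀ p₀ j Ts ρ ρ' Φ J 0 p.1 p.2) ∂(((fieldMeasure (F.P j) 0 ↥(Matrix.specialUnitaryGroup (Fin 2) ℂ)).restrict A).prod τ)
      = ∫⁻ U in B ∩ (descendTo F ℰp j Ts (Nat.le_of_succ_le hjTs) ⁻¹' A), ENNReal.ofReal (mwCut F γ b₀ p₀ j Ts U * ρ' Ts U)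
          ∂(fieldMeasure (F.P Ts) 0 ↥(Matrix.specialUnitaryGroup (Fin 2) ℂ)) :=
  setLIntegral_prod_eq_of_chart F γ b₀ p₀ j Ts hjTs hχm hχsupp τ Φ J S hΦm hJm hSm hS hdis (ρ' Ts) hρ'm
    (fun p => wNum F γ b₀ p₀ j Ts ρ ρ' Φ J 0 p.1 p.2)
    (fun p => by simp only [wNum, Real.rpow_eq_pow, Real.rpow_one, sub_zero, Real.rpow_zero, one_mul, Prod.mk.eta]) hA hB

/-- Cut mass ≤ unconditional mass: `∫⁻_{B ∩ D} ofReal(χ·f) ≤ ∫⁻_B ofReal f = (m.withDensity (ofReal ∘ f)) B` for `0 ≤ χ ≤ 1`, `B` measurable, any sign of `f`. [folklore] -/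
theorem setLIntegral_ofReal_cut_le_withDensity {X : Type*} [MeasurableSpace X] (m : Measure X) {χ f : X → ℝ}
    (hχ0 : ∀ x, 0 ≤ χ x) (hχ1 : ∀ x, χ x ≤ 1) {B : Set X} (D : Set X) (hB : MeasurableSet B) :
    ∫⁻ x in B ∩ D, ENNReal.ofReal (χ x * f x) ∂m ≤ (m.withDensity fun x => ENNReal.ofReal (f x)) B := by
  have hpt : ∀ x, ENNReal.ofReal (χ x * f x) ≤ ENNReal.ofReal (f x) := by
    intro x
    rcases le_or_gt 0 (f x) with hf | hf
    · apply ENNReal.ofReal_le_ofReal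
      calc χ x * f x ≤ 1 * f x := mul_le_mul_of_nonneg_right (hχ1 x) hf
        _ = f x := one_mul _
    · rw [ENNReal.ofReal_of_nonpos (mul_nonpos_of_nonneg_of_nonpos (hχ0 x) hf.le)]
      exact zero_le
  calc ∫⁻ x in B ∩ D, ENNReal.ofReal (χ x * f x) ∂m
      ≤ ∫⁻ x in B, ENNReal.ofReal (χ x * f x) ∂m := lintegral_mono_set Set.inter_subset_left
    _ ≤ ∫⁻ x in B, ENNReal.ofReal (f x) ∂m := lintegral_mono fun x => hpt x
    _ = (m.withDensity fun x => ENNReal.ofReal (f x)) B := (withDensity_apply _ hB).symm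

/-! ## §2 The joint-averaged per-`t` tail is at most the larger endpoint unconditional mass -/

/-- ★★ **THE JOINT-AVERAGED PER-`t` TAIL IS FREE** (UV3-NODE §106 ADDENDUM (a); LEAD RULING №63's ledger of record, «FREE» half) — in the frame's letters, with the
row's chart clauses as hypotheses (`hS`, `hdis` VERBATIM the shapes of ✓`…RunpairOrganFibreLawJSqEDefs` l.117; `hμ`, `hμ'` the row's density clause read at height `Ts`;
`0 ≤ χ ≤ 1`): for every `t ∈ [0,1]`, measurable window set `A` and measurable fine event `B`,
`∫⁻_{Φ⁻¹B} wNum_t d((fieldMeasure_j|_A) ⊗ τ) ≤ (μ_Ts B)^t · (μ′_Ts B)^{1−t} ≤ max(μ_Ts B, μ′_Ts B)`.  No normalisation, no Jensen∕KL∕variance letter; uniform in `t`.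
[folklore] -/
theorem setLIntegral_wNum_prod_le_max_endpointMass (F : T3Family) (γ b₀ p₀ : ℝ) (j Ts : ℕ) (hjTs : j + 1 ≤ Ts)
    (ρ ρ' : (i : ℕ) → GaugeField (F.P i) 0 ↥(Matrix.specialUnitaryGroup (Fin 2) ℂ) → ℝ) (hρm : Measurable (ρ Ts)) (hρ'm : Measurable (ρ' Ts))
    (hρpos : ∀ U, PlaqSmall (θBal F.L γ b₀ p₀ Ts) U → 0 < ρ Ts U ∧ 0 < ρ' Ts U) (hθ : 0 < θBal F.L γ b₀ p₀ Ts)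
    (hχm : Measurable (mwCut F γ b₀ p₀ j Ts)) (hχ0 : ∀ U, 0 ≤ mwCut F γ b₀ p₀ j Ts U) (hχ1 : ∀ U, mwCut F γ b₀ p₀ j Ts U ≤ 1)
    (hχsupp : ∀ U, mwCut F γ b₀ p₀ j Ts U ≠ 0 → ∀ (n : ℕ) (hjn : j + 1 ≤ n) (hnK : n ≤ Ts), PlaqSmall (24 / 25 * θBal F.L γ b₀ p₀ n) (descendTo F ℰp n Ts hnK U))
    {Z : Type} [MeasurableSpace Z] (τ : Measure Z)
    (Φ : GaugeField (F.P j) 0 ↥(Matrix.specialUnitaryGroup (Fin 2) ℂ) × Z → GaugeField (F.P Ts) 0 ↥(Matrix.specialUnitaryGroup (Fin 2) ℂ))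
    (J : GaugeField (F.P j) 0 ↥(Matrix.specialUnitaryGroup (Fin 2) ℂ) × Z → ℝ≥0)
    (S : Set (GaugeField (F.P Ts) 0 ↥(Matrix.specialUnitaryGroup (Fin 2) ℂ))) (hΦm : Measurable Φ) (hJm : Measurable J) (hSm : MeasurableSet S)
    (hS : ∀ U, (∀ (n : ℕ) (hjn : j + 1 ≤ n) (hnK : n ≤ Ts), PlaqSmall (24 / 25 * θBal F.L γ b₀ p₀ n) (descendTo F ℰp n Ts hnK U)) → U ∈ S)
    (hdis : ∀ A : Set (GaugeField (F.P j) 0 ↥(Matrix.specialUnitaryGroup (Fin 2) ℂ)), MeasurableSet A →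
      (fieldMeasure (F.P Ts) 0 ↥(Matrix.specialUnitaryGroup (Fin 2) ℂ)).restrict (descendTo F ℰp j Ts (Nat.le_of_succ_le hjTs) ⁻¹' A ∩ S)
        = ((((fieldMeasure (F.P j) 0 ↥(Matrix.specialUnitaryGroup (Fin 2) ℂ)).restrict A).prod τ).withDensity (fun p => (J p : ENNReal))).map Φ)
    (μ μ' : (i : ℕ) → Measure (GaugeField (F.P i) 0 ↥(Matrix.specialUnitaryGroup (Fin 2) ℂ))) (hμ : μ Ts = (fieldMeasure _ _ _).withDensity (fun U => ENNReal.ofReal (ρ Ts U)))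
    (hμ' : μ' Ts = (fieldMeasure _ _ _).withDensity (fun U => ENNReal.ofReal (ρ' Ts U)))
    (t : ℝ) (ht0 : 0 ≤ t) (ht1 : t ≤ 1) {A : Set (GaugeField (F.P j) 0 ↥(Matrix.specialUnitaryGroup (Fin 2) ℂ))} (hA : MeasurableSet A)
    {B : Set (GaugeField (F.P Ts) 0 ↥(Matrix.specialUnitaryGroup (Fin 2) ℂ))} (hB : MeasurableSet B) :
    ∫⁻ p in Φ ⁻¹' B, ENNReal.ofReal (wNum F γ b₀ p₀ j Ts ρ ρ' Φ J t p.1 p.2) ∂(((fieldMeasure (F.P j) 0 ↥(Matrix.specialUnitaryGroup (Fin 2) ℂ)).restrict A).prod τ)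
        ≤ (μ Ts B) ^ t * (μ' Ts B) ^ (1 - t) ∧
      ∫⁻ p in Φ ⁻¹' B, ENNReal.ofReal (wNum F γ b₀ p₀ j Ts ρ ρ' Φ J t p.1 p.2) ∂(((fieldMeasure (F.P j) 0 ↥(Matrix.specialUnitaryGroup (Fin 2) ℂ)).restrict A).prod τ)
        ≤ max (μ Ts B) (μ' Ts B) := by
  have hH := (setLIntegral_wNum_prod_le_max F γ b₀ p₀ j Ts hjTs ρ ρ' hρm hρ'm hρpos hθ hχm hχ0 hχsupp Φ J hΦm hJm
    (((fieldMeasure (F.P j) 0 ↥(Matrix.specialUnitaryGroup (Fin 2) ℂ)).restrict A).prod τ) t ht0 ht1 (Φ ⁻¹' B)).1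
  have h1 : ∫⁻ p in Φ ⁻¹' B, ENNReal.ofReal (wNum F γ b₀ p₀ j Ts ρ ρ' Φ J 1 p.1 p.2)
        ∂(((fieldMeasure (F.P j) 0 ↥(Matrix.specialUnitaryGroup (Fin 2) ℂ)).restrict A).prod τ) ≤ μ Ts B := by
    rw [setLIntegral_wNum_one_prod_eq F γ b₀ p₀ j Ts hjTs ρ ρ' hρm hχm hχsupp τ Φ J S hΦm hJm hSm hS hdis hA hB, hμ]
    exact setLIntegral_ofReal_cut_le_withDensity _ hχ0 hχ1 _ hB
  have h0 : ∫⁻ p in Φ ⁻¹' B, ENNReal.ofReal (wNum F γ b₀ p₀ j Ts ρ ρ' Φ J 0 p.1 p.2)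
        ∂(((fieldMeasure (F.P j) 0 ↥(Matrix.specialUnitaryGroup (Fin 2) ℂ)).restrict A).prod τ) ≤ μ' Ts B := by
    rw [setLIntegral_wNum_zero_prod_eq F γ b₀ p₀ j Ts hjTs ρ ρ' hρ'm hχm hχsupp τ Φ J S hΦm hJm hSm hS hdis hA hB, hμ']
    exact setLIntegral_ofReal_cut_le_withDensity _ hχ0 hχ1 _ hB
  have h1t : 0 ≤ 1 - t := by linarith
  have hgm : ∫⁻ p in Φ ⁻¹' B, ENNReal.ofReal (wNum F γ b₀ p₀ j Ts ρ ρ' Φ J t p.1 p.2)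
        ∂(((fieldMeasure (F.P j) 0 ↥(Matrix.specialUnitaryGroup (Fin 2) ℂ)).restrict A).prod τ) ≤ (μ Ts B) ^ t * (μ' Ts B) ^ (1 - t) :=
    hH.trans (mul_le_mul' (ENNReal.rpow_le_rpow h1 ht0) (ENNReal.rpow_le_rpow h0 h1t))
  refine ⟨hgm, hgm.trans ?_⟩
  calc (μ Ts B) ^ t * (μ' Ts B) ^ (1 - t) ≤ (max (μ Ts B) (μ' Ts B)) ^ t * (max (μ Ts B) (μ' Ts B)) ^ (1 - t) :=
        mul_le_mul' (ENNReal.rpow_le_rpow (le_max_left _ _) ht0) (ENNReal.rpow_le_rpow (le_max_right _ _) h1t)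
    _ = max (μ Ts B) (μ' Ts B) := by rw [← ENNReal.rpow_add_of_nonneg _ _ ht0 h1t]; norm_num

/-- Tonelli over a `Φ`-preimage: `∫⁻_{Φ⁻¹B} G d((m|_A) ⊗ τ) = ∫⁻_{V ∈ A} ∫⁻_{z : Φ(V,z) ∈ B} G(V,z) dτ dm` (`τ` s-finite, `G`, `B` measurable). [folklore] -/
theorem setLIntegral_preimage_prod_eq_lintegral_fibre {X Y Z : Type*} [MeasurableSpace X] [MeasurableSpace Y] [MeasurableSpace Z]
    (m : Measure X) (τ : Measure Z) [SFinite τ] {Φ : X × Z → Y} (hΦm : Measurable Φ) {G : X × Z → ℝ≥0∞} (hG : Measurable G)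
    (A : Set X) {B : Set Y} (hB : MeasurableSet B) :
    ∫⁻ p in Φ ⁻¹' B, G p ∂((m.restrict A).prod τ) = ∫⁻ V in A, (∫⁻ z in {z | Φ (V, z) ∈ B}, G (V, z) ∂τ) ∂m := by
  have hE : MeasurableSet (Φ ⁻¹' B) := hΦm hB
  rw [← lintegral_indicator hE, lintegral_prod _ (hG.indicator hE).aemeasurable]
  refine lintegral_congr fun V => ?_
  have hsec : MeasurableSet {z | Φ (V, z) ∈ B} := (hΦm.comp (measurable_const.prodMk measurable_id)) hB
  rw [← lintegral_indicator hsec]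
  rfl

/-- ★★ **THE `Z_t·dV`-AVERAGED FIBRE TAIL IS AT MOST THE LARGER ENDPOINT UNCONDITIONAL MASS** (§106 ADDENDUM (a) displayed as an average over window points):
for every `t ∈ [0,1]`, measurable window set `A` and measurable fine event `B`,
`∫⁻_{V ∈ A} ( ∫⁻_{z : Φ(V,z) ∈ B} wNum_t(V,z) dτ ) d(fieldMeasure_j) ≤ max(μ_Ts B, μ′_Ts B)`.
The inner integral is `Z_t(V)·tail_t(V)` (fibre normaliser × `ŵ_t(V,·)`-mass of `{z | Φ(V,z) ∈ B}`); NO `J`∕KL letter (RULING №63: nothing is divided by `Z_t`). [folklore] -/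
theorem lintegral_fibreTail_le_max_endpointMass (F : T3Family) (γ b₀ p₀ : ℝ) (j Ts : ℕ) (hjTs : j + 1 ≤ Ts)
    (ρ ρ' : (i : ℕ) → GaugeField (F.P i) 0 ↥(Matrix.specialUnitaryGroup (Fin 2) ℂ) → ℝ) (hρm : Measurable (ρ Ts)) (hρ'm : Measurable (ρ' Ts))
    (hρpos : ∀ U, PlaqSmall (θBal F.L γ b₀ p₀ Ts) U → 0 < ρ Ts U ∧ 0 < ρ' Ts U) (hθ : 0 < θBal F.L γ b₀ p₀ Ts)
    (hχm : Measurable (mwCut F γ b₀ p₀ j Ts)) (hχ0 : ∀ U, 0 ≤ mwCut F γ b₀ p₀ j Ts U) (hχ1 : ∀ U, mwCut F γ b₀ p₀ j Ts U ≤ 1)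
    (hχsupp : ∀ U, mwCut F γ b₀ p₀ j Ts U ≠ 0 → ∀ (n : ℕ) (hjn : j + 1 ≤ n) (hnK : n ≤ Ts), PlaqSmall (24 / 25 * θBal F.L γ b₀ p₀ n) (descendTo F ℰp n Ts hnK U))
    {Z : Type} [MeasurableSpace Z] (τ : Measure Z) [IsProbabilityMeasure τ]
    (Φ : GaugeField (F.P j) 0 ↥(Matrix.specialUnitaryGroup (Fin 2) ℂ) × Z → GaugeField (F.P Ts) 0 ↥(Matrix.specialUnitaryGroup (Fin 2) ℂ))
    (J : GaugeField (F.P j) 0 ↥(Matrix.specialUnitaryGroup (Fin 2) ℂ) × Z → ℝ≥0)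
    (S : Set (GaugeField (F.P Ts) 0 ↥(Matrix.specialUnitaryGroup (Fin 2) ℂ))) (hΦm : Measurable Φ) (hJm : Measurable J) (hSm : MeasurableSet S)
    (hS : ∀ U, (∀ (n : ℕ) (hjn : j + 1 ≤ n) (hnK : n ≤ Ts), PlaqSmall (24 / 25 * θBal F.L γ b₀ p₀ n) (descendTo F ℰp n Ts hnK U)) → U ∈ S)
    (hdis : ∀ A : Set (GaugeField (F.P j) 0 ↥(Matrix.specialUnitaryGroup (Fin 2) ℂ)), MeasurableSet A →
      (fieldMeasure (F.P Ts) 0 ↥(Matrix.specialUnitaryGroup (Fin 2) ℂ)).restrict (descendTo F ℰp j Ts (Nat.le_of_succ_le hjTs) ⁻¹' A ∩ S)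
        = ((((fieldMeasure (F.P j) 0 ↥(Matrix.specialUnitaryGroup (Fin 2) ℂ)).restrict A).prod τ).withDensity (fun p => (J p : ENNReal))).map Φ)
    (μ μ' : (i : ℕ) → Measure (GaugeField (F.P i) 0 ↥(Matrix.specialUnitaryGroup (Fin 2) ℂ))) (hμ : μ Ts = (fieldMeasure _ _ _).withDensity (fun U => ENNReal.ofReal (ρ Ts U)))
    (hμ' : μ' Ts = (fieldMeasure _ _ _).withDensity (fun U => ENNReal.ofReal (ρ' Ts U)))
    (t : ℝ) (ht0 : 0 ≤ t) (ht1 : t ≤ 1) {A : Set (GaugeField (F.P j) 0 ↥(Matrix.specialUnitaryGroup (Fin 2) ℂ))} (hA : MeasurableSet A)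
    {B : Set (GaugeField (F.P Ts) 0 ↥(Matrix.specialUnitaryGroup (Fin 2) ℂ))} (hB : MeasurableSet B) :
    ∫⁻ V in A, (∫⁻ z in {z | Φ (V, z) ∈ B}, ENNReal.ofReal (wNum F γ b₀ p₀ j Ts ρ ρ' Φ J t V z) ∂τ) ∂(fieldMeasure (F.P j) 0 ↥(Matrix.specialUnitaryGroup (Fin 2) ℂ))
      ≤ max (μ Ts B) (μ' Ts B) := by
  have h := (setLIntegral_wNum_prod_le_max_endpointMass F γ b₀ p₀ j Ts hjTs ρ ρ' hρm hρ'm hρpos hθ hχm hχ0 hχ1 hχsupp τ Φ J S hΦm hJm hSm hS hdis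
    μ μ' hμ hμ' t ht0 ht1 hA hB).2
  rwa [setLIntegral_preimage_prod_eq_lintegral_fibre _ τ hΦm
    (measurable_wNum_uncurry F γ b₀ p₀ j Ts ρ ρ' hρm hρ'm hχm Φ J hΦm hJm t).ennreal_ofReal A hB] at h

/-- ★ **… WITH THE TWO η-TYPE LETTERS AT A REDUCED THRESHOLD** — if `μ_Ts{¬PlaqSmall θ′} ≤ ofReal η♭` and `μ′_Ts{¬PlaqSmall θ′} ≤ ofReal η♭′` (the η-letter SHAPE of
the row, `μ j {U | ¬ PlaqSmall (θBal …) U} ≤ ENNReal.ofReal (η j)`, at an arbitrary threshold `θ′` — e.g. `θ_Ts∕4 − 3·Db·rc`; print for such a letter: [Balaban1985UV3]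
(67)–(71) p. 273, NOT asserted here), then for every `t ∈ [0,1]` and measurable window set `A`:
`∫⁻_{V ∈ A} ( ∫⁻_{z : ¬PlaqSmall θ′ (Φ(V,z))} wNum_t(V,z) dτ ) d(fieldMeasure_j) ≤ ofReal (max η♭ η♭′)`. [folklore] -/
theorem lintegral_fibreTail_compl_plaqSmall_le_of_eta (F : T3Family) (γ b₀ p₀ : ℝ) (j Ts : ℕ) (hjTs : j + 1 ≤ Ts)
    (ρ ρ' : (i : ℕ) → GaugeField (F.P i) 0 ↥(Matrix.specialUnitaryGroup (Fin 2) ℂ) → ℝ) (hρm : Measurable (ρ Ts)) (hρ'm : Measurable (ρ' Ts))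
    (hρpos : ∀ U, PlaqSmall (θBal F.L γ b₀ p₀ Ts) U → 0 < ρ Ts U ∧ 0 < ρ' Ts U) (hθ : 0 < θBal F.L γ b₀ p₀ Ts)
    (hχm : Measurable (mwCut F γ b₀ p₀ j Ts)) (hχ0 : ∀ U, 0 ≤ mwCut F γ b₀ p₀ j Ts U) (hχ1 : ∀ U, mwCut F γ b₀ p₀ j Ts U ≤ 1)
    (hχsupp : ∀ U, mwCut F γ b₀ p₀ j Ts U ≠ 0 → ∀ (n : ℕ) (hjn : j + 1 ≤ n) (hnK : n ≤ Ts), PlaqSmall (24 / 25 * θBal F.L γ b₀ p₀ n) (descendTo F ℰp n Ts hnK U))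
    {Z : Type} [MeasurableSpace Z] (τ : Measure Z) [IsProbabilityMeasure τ]
    (Φ : GaugeField (F.P j) 0 ↥(Matrix.specialUnitaryGroup (Fin 2) ℂ) × Z → GaugeField (F.P Ts) 0 ↥(Matrix.specialUnitaryGroup (Fin 2) ℂ))
    (J : GaugeField (F.P j) 0 ↥(Matrix.specialUnitaryGroup (Fin 2) ℂ) × Z → ℝ≥0)
    (S : Set (GaugeField (F.P Ts) 0 ↥(Matrix.specialUnitaryGroup (Fin 2) ℂ))) (hΦm : Measurable Φ) (hJm : Measurable J) (hSm : MeasurableSet S)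
    (hS : ∀ U, (∀ (n : ℕ) (hjn : j + 1 ≤ n) (hnK : n ≤ Ts), PlaqSmall (24 / 25 * θBal F.L γ b₀ p₀ n) (descendTo F ℰp n Ts hnK U)) → U ∈ S)
    (hdis : ∀ A : Set (GaugeField (F.P j) 0 ↥(Matrix.specialUnitaryGroup (Fin 2) ℂ)), MeasurableSet A →
      (fieldMeasure (F.P Ts) 0 ↥(Matrix.specialUnitaryGroup (Fin 2) ℂ)).restrict (descendTo F ℰp j Ts (Nat.le_of_succ_le hjTs) ⁻¹' A ∩ S)
        = ((((fieldMeasure (F.P j) 0 ↥(Matrix.specialUnitaryGroup (Fin 2) ℂ)).restrict A).prod τ).withDensity (fun p => (J p : ENNReal))).map Φ)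
    (μ μ' : (i : ℕ) → Measure (GaugeField (F.P i) 0 ↥(Matrix.specialUnitaryGroup (Fin 2) ℂ))) (hμ : μ Ts = (fieldMeasure _ _ _).withDensity (fun U => ENNReal.ofReal (ρ Ts U)))
    (hμ' : μ' Ts = (fieldMeasure _ _ _).withDensity (fun U => ENNReal.ofReal (ρ' Ts U)))
    (θ' ηf ηf' : ℝ) (hη : μ Ts {U | ¬ PlaqSmall θ' U} ≤ ENNReal.ofReal ηf) (hη' : μ' Ts {U | ¬ PlaqSmall θ' U} ≤ ENNReal.ofReal ηf')
    (t : ℝ) (ht0 : 0 ≤ t) (ht1 : t ≤ 1) {A : Set (GaugeField (F.P j) 0 ↥(Matrix.specialUnitaryGroup (Fin 2) ℂ))} (hA : MeasurableSet A) :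
    ∫⁻ V in A, (∫⁻ z in {z | ¬ PlaqSmall θ' (Φ (V, z))}, ENNReal.ofReal (wNum F γ b₀ p₀ j Ts ρ ρ' Φ J t V z) ∂τ)
        ∂(fieldMeasure (F.P j) 0 ↥(Matrix.specialUnitaryGroup (Fin 2) ℂ)) ≤ ENNReal.ofReal (max ηf ηf') := by
  classical
  haveI : BorelSpace (GaugeField (F.P Ts) 0 ↥(Matrix.specialUnitaryGroup (Fin 2) ℂ)) :=
    Literature.MathematicalPhysics.QuantumFieldTheory.Balaban1983to89.T3OrbitAverage.instBorelSpaceGaugeField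
  have hB : MeasurableSet {U : GaugeField (F.P Ts) 0 ↥(Matrix.specialUnitaryGroup (Fin 2) ℂ) | ¬ PlaqSmall θ' U} :=
    (Summit.QuantumFields.YangMills.BalabanUVNodes.N09DomAltThresholdNull.isOpen_setOf_plaqSmall_SU 2 _ _ _).measurableSet.compl
  have h := lintegral_fibreTail_le_max_endpointMass F γ b₀ p₀ j Ts hjTs ρ ρ' hρm hρ'm hρpos hθ hχm hχ0 hχ1 hχsupp τ Φ J S hΦm hJm hSm hS hdis
    μ μ' hμ hμ' t ht0 ht1 hA hB
  refine h.trans ?_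
  rw [ENNReal.ofReal_max]
  exact max_le_max hη hη'

end Summit.QuantumFields.YangMills.Theorems.OrganTangentGoodSetTailJointHolder

end
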